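import Literature.Geometry.DiscreteGeometry.EnergyLinearProgrammingBound

/-!
# The regular simplex bound: `N = n + 1` points on `S^{n-1}` and any potential with a supporting line

Framing: lottery ticket; floor = certified bounds/negative ranges. Venture `PackingBounds` (cell
`pub-packcert`, seat `pub-packcert-energy`), energy-minimisation family, **universal + control**
(valid for every dimension `n ≥ 3` and a whole CLASS of potentials, not one certificate per row).

**Theorem.** Let `n ≥ 3`, let `a : ℝ → ℝ` be a potential of the inner product which admits a
supporting line of slope `m ≥ 0` at `t₀ = -1/n` on `[-1, 1)`, i.e.
`a(t) ≥ a(-1/n) + m (t + 1/n)` for `-1 ≤ t < 1`, and assume `a(-1/n) + m/n ≥ 0` (automatic for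
nonnegative potentials). Then every configuration of `n + 1` unit vectors `C ⊂ ℝⁿ` satisfies
`Σ_{x ≠ y ∈ C} a(⟨x, y⟩) ≥ (n + 1) n · a(-1/n)`,
with equality for the regular simplex (all inner products `-1/n`). Every absolutely (indeed every
convex, non-decreasing, nonnegative) potential qualifies with `m = a'(-1/n)`, so this is the
universal optimality of the regular simplex (Cohn–Kumar 2007, Thm. 1.2, first line of Table 1) in
the form the linear programming bound delivers it: the degree-`1` certificate
`h(t) = a(t₀) + m (t - t₀) = (a(t₀) + m/n) C_0 + (m / (n - 2)) C_1^{((n-2)/2)}(t)`.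

Proof: `Literature.Geometry.DiscreteGeometry.EnergyLP.energy_ge_inner` with `d = 1` and the two
coefficients above (`C_1^{(μ)}(t) = 2 μ t`, `gegenbauerSum_one`); the value
`(n+1)² α_0 - (n+1) h(1)` simplifies to `(n+1) n a(-1/n)` because `N - 1 = n`.

## References
* H. Cohn, A. Kumar, J. Amer. Math. Soc. 20 (2007) 99–148, Thm. 1.2 and Prop. 4.1. [`CohnKumar2006`]
-/

namespace Summit.Ventures.PackingBounds.Energy

open Finset Literature.Analysis.SpecialFunctions Literature.Geometry.DiscreteGeometry

open scoped Classical in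
/-- **Universal lower bound attained by the regular simplex.** For `n ≥ 3`, a potential `a` with
a supporting line of slope `m ≥ 0` at `-1/n` on `[-1,1)` and `a(-1/n) + m/n ≥ 0`, every set of
`n + 1` unit vectors of `ℝⁿ` has `Σ_{x ≠ y} a(⟨x,y⟩) ≥ (n+1) n a(-1/n)` (sharp for the regular
simplex). Degree-one LP certificate. [cite: CohnKumar2006, Theorem 1.2 and Proposition 4.1] -/
theorem simplex_energy_ge {n : ℕ} (hn : 3 ≤ n) (a : ℝ → ℝ) (m : ℝ) (hm : 0 ≤ m)
    (hsupp : ∀ t : ℝ, -1 ≤ t → t < 1 → a (-1 / n) + m * (t + 1 / n) ≤ a t)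
    (ha0 : 0 ≤ a (-1 / n) + m / n)
    (C : Finset (EuclideanSpace ℝ (Fin n))) (h1 : ∀ x ∈ C, ‖x‖ = 1) (hN : C.card = n + 1) :
    ((n : ℝ) + 1) * n * a (-1 / n) ≤ ∑ x ∈ C, ∑ y ∈ C.erase x, a (inner ℝ x y) := by
  have hn3 : (3 : ℝ) ≤ n := by exact_mod_cast hn
  have hnpos : (0 : ℝ) < n := by linarith
  set μ : ℝ := ((n : ℝ) - 2) / 2 with hμdef
  have hμ : 0 < μ := by rw [hμdef]; linarith
  have hnμ : (n : ℝ) = 2 * μ + 2 := by rw [hμdef]; ring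
  have h2μ : 2 * μ = (n : ℝ) - 2 := by rw [hμdef]; ring
  have hμne : (n : ℝ) - 2 ≠ 0 := by linarith
  -- the degree-one certificate
  set α : ℕ → ℝ := fun k => if k = 0 then a (-1 / n) + m / n else if k = 1 then m / ((n : ℝ) - 2)
    else 0 with hαdef
  have hα : ∀ k, 0 ≤ α k := by
    intro k
    simp only [hαdef]
    split_ifs
    · exact ha0
    · exact div_nonneg hm (by linarith)
    · exact le_rfl
  have hpoly : ∀ t : ℝ, ∑ k ∈ range (1 + 1), α k * gegenbauerSum μ k t =
      a (-1 / n) + m * (t + 1 / n) := by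
    intro t
    simp only [Finset.sum_range_succ, Finset.sum_range_zero, gegenbauerSum_zero, gegenbauerSum_one,
      hαdef]
    simp only [if_true, one_ne_zero, if_false]
    rw [h2μ]
    field_simp
    ring
  have hH : ∀ t : ℝ, -1 ≤ t → t < 1 → ∑ k ∈ range (1 + 1), α k * gegenbauerSum μ k t ≤ a t := by
    intro t ht1 ht2
    rw [hpoly t]
    exact hsupp t ht1 ht2
  have key := EnergyLP.energy_ge_inner hnμ hμ 1 α hα a hH C h1
  rw [hN, hpoly 1] at key
  have hα0 : α 0 = a (-1 / n) + m / n := by simp [hαdef]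
  rw [hα0] at key
  have hval : (((n + 1 : ℕ) : ℝ)) ^ 2 * (a (-1 / n) + m / n) -
      ((n + 1 : ℕ) : ℝ) * (a (-1 / n) + m * (1 + 1 / n)) = ((n : ℝ) + 1) * n * a (-1 / n) := by
    push_cast
    field_simp
    ring
  linarith [key, hval]

end Summit.Ventures.PackingBounds.Energy
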